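import Literature.Computability.QuantumComplexity.PermanentSearch
import Literature.Computability.AlgebraicComplexity.PermanentCodeTranscoder
import Literature.Computability.Complexity.ZIntBricks
import HarnessLib

/-!
# Row-major words of `0/1` matrices: the row surgery of the AA13 permanent search as `FP` bricks

Aaronson–Arkhipov, *The computational complexity of linear optics*, Theory of Computing 9 (2013),
proof of Thm. 4.3 (p. 176): the search for `Per(X)` of a `0/1` matrix recurses on the bottom-right
minor after "permuting the rows" so that a row with `x_{p1} = 1` and a minor of nonzero permanent
comes first. In the tree (`PermanentSearch.lean`, `perLevel`) these are the reindexings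
`X.submatrix (Fin.cons p p.succAbove) id` (named `PerSearch.perm` in `PermanentSearchReplay.lean`) and
`Y.submatrix Fin.succ Fin.succ` (`PerSearch.minor` there); this file states everything with the
`submatrix` forms, so that it does not depend on that file. A machine realising the search
(`PerSearch.randSearchAlg_isPolyTime`) holds a `0/1` matrix of dimension `k` as its **row-major
word** of `k²` bits (the convention of `PermanentBitsPPoly.lean`/`PermanentCodeTranscoder.lean`:
`wordBits`, `bitMatrix`, `plainWord`); this file supplies that layer:

* `PerSearch.wmat k w` — the `0/1` matrix of a word (`= bitMatrix k (wordBits w k)`), always `0/1`;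
* the word operations `rowW` (row `i`), `permW` (row `p` moved to the top: `row p ++ rows < p ++ rows > p`)
  and `minorW` (rows and columns `≥ 1`), with
  **`wmat_permW : wmat (m+1) (permW (m+1) w p) = (wmat (m+1) w).submatrix (Fin.cons p p.succAbove) id`**
  and **`wmat_minorW : wmat m (minorW m w) = (wmat (m+1) w).submatrix Fin.succ Fin.succ`** for words
  of the right length (index bookkeeping with `List.getD` over `take`/`drop`/`++` and `ccat`), and
  `submatrix_succAbove_succ` (the pivot-test minor `X.submatrix p.succAbove Fin.succ` is the minor of
  the permuted matrix);
* the bricks `mulUF` (`1^{min(i k, |w|)}`), `rowWF`, `permWF` (on `⟨⟨w, 1ᵏ⟩, 1ⁱ⟩`) and `minorWF`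
  (on `⟨w, 1ᵐ⟩`, a concatenation fold `Brick.foldLoop appF` of clipped row pieces), each in `FP`
  with its value on the intended records (`rowWF_apply`, `permWF_apply`, `minorWF_apply`) and an
  output-length bound valid on every input;
* the **query codes**: `encode_matrix_flat` (the `encodingIntMatrix` code of any matrix, flat:
  header, fuel, `ccat` of row codes — the general form of `encode_sq_eq`), `matC_wmat` (the
  transcoder's `matC` codes the matrix of a word of square length), and for the search queries
  `X^{[r]}` of AA13 eq. (4.3) — realised on integer matrices as `scaledMatrix X r`, first row
  `D x₀ⱼ − [j = 0] a` for `r = a/D` — the word form `scaleW` (`scaledMatrix_wmat`) and the brick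
  **`smatC`** on `⟨⟨w, 1ᵏ⟩, ⟨A, D⟩⟩` (`A` a difference pair of value `a`, `D` a numeral) with
  `smatC_apply : smatC … = encodingIntMatrix.encode ⟨k, scaleW k w a D⟩` (row `0` by a fold of the
  sign–magnitude entry codes `ent0C`, rows `≥ 1` by a fold of the transcoder's row codes `rowC`).

## References

* S. Aaronson, A. Arkhipov, *The computational complexity of linear optics*, Theory of Computing 9
  (2013), proof of Thm. 4.3 (p. 176), eq. (4.3).
* S. Arora, B. Barak, *Computational Complexity: A Modern Approach*, CUP 2009, §0.1 (codes),
  §1.3 (closure of polynomial time under composition and bounded loops).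
-/

noncomputable section

namespace Literature.Computability.QuantumComplexity

open _root_.Computability Complexity Complexity.Brick Complexity.Plumb Matrix Literature.Computability.AlgebraicComplexity

namespace PerSearch

/-! ### Indexed concatenations of pieces of equal length -/

/-- Length of a `ccat` whose pieces below `n` have length `m`. [folklore] -/
theorem length_ccat_of_lt (g : ℕ → List Bool) {m : ℕ} :
    ∀ n : ℕ, (∀ i < n, (g i).length = m) → (ccat g n).length = n * m
  | 0, _ => by simp
  | n + 1, h => by
    rw [ccat_succ, List.length_append, length_ccat_of_lt g n (fun i hi => h i (by omega)), h n (by omega), Nat.succ_mul]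

/-- Reading a `ccat` of pieces of length `m` (below `n`) at position `i m + j`. [folklore] -/
theorem getD_ccat_of_lt (g : ℕ → List Bool) {m : ℕ} (d : Bool) :
    ∀ (n : ℕ), (∀ i < n, (g i).length = m) → ∀ {i j : ℕ}, i < n → j < m → (ccat g n).getD (i * m + j) d = (g i).getD j d
  | 0, _, i, j, hi, _ => absurd hi (Nat.not_lt_zero _)
  | n + 1, h, i, j, hi, hj => by
    have hn : (ccat g n).length = n * m := length_ccat_of_lt g n fun i hi => h i (by omega)
    rw [ccat_succ]
    rcases Nat.lt_succ_iff_lt_or_eq.1 hi with hi' | rfl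
    · rw [List.getD_append _ _ _ _ (by rw [hn]; nlinarith),
        getD_ccat_of_lt g d n (fun i hi => h i (by omega)) hi' hj]
    · rw [show i * m + j = (ccat g i).length + j by rw [hn], List.getD_append_right _ _ _ _ (Nat.le_add_right _ _),
        Nat.add_sub_cancel_left]

/-! ### The matrix of a word -/

/-- **The `0/1` matrix of dimension `k` of a row-major word**: entry `(i, j)` is `1` iff bit
`i k + j` is set (missing bits read `0`). [cite: AroraBarak2009, §0.1] -/
def wmat (k : ℕ) (w : List Bool) : Matrix (Fin k) (Fin k) ℤ :=
  Matrix.of fun i j => if w.getD (i * k + j) false then 1 else 0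

/-- Entries of the matrix of a word. [folklore] -/
@[simp] theorem wmat_apply (k : ℕ) (w : List Bool) (i j : Fin k) :
    wmat k w i j = if w.getD (i * k + j) false then 1 else 0 := rfl

/-- The matrix of a word is the `bitMatrix` of its `wordBits` (`PermanentBitsPPoly.lean`). [folklore] -/
theorem wmat_eq_bitMatrix (k : ℕ) (w : List Bool) : wmat k w = bitMatrix k (wordBits w k) := rfl

/-- The matrix of a word is a `0/1` matrix. [folklore] -/
theorem isZeroOne_wmat (k : ℕ) (w : List Bool) : IsZeroOne (wmat k w) := fun i j => by
  rw [wmat_apply]; split_ifs <;> simp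

/-- For a `0/1` code (`IsZeroOneCode`), the matrix of its row-major word `plainWord` is the coded
matrix. [folklore] -/
theorem wmat_plainWord {y : List Bool} (h : IsZeroOneCode y) :
    wmat (codeDim y) (plainWord y) = Matrix.of fun i j : Fin (codeDim y) => intOfCode (codeEntry y i j) := by
  rw [wmat_eq_bitMatrix, bitMatrix_plainWord h]

/-! ### Rows, the pivot permutation and the minor, on words -/

/-- Row `i` of the word of a dimension-`k` matrix. [folklore] -/
def rowW (k : ℕ) (w : List Bool) (i : ℕ) : List Bool := (w.drop (i * k)).take k

/-- Bits of a row. [folklore] -/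
theorem getD_rowW (k : ℕ) (w : List Bool) (i : ℕ) {j : ℕ} (hj : j < k) :
    (rowW k w i).getD j false = w.getD (i * k + j) false := by
  rw [rowW, List.getD_eq_getElem?_getD, List.getElem?_take, if_pos hj, List.getElem?_drop, ← List.getD_eq_getElem?_getD]

/-- Length of a row inside the word. [folklore] -/
theorem length_rowW {k : ℕ} {w : List Bool} {i : ℕ} (h : (i + 1) * k ≤ w.length) : (rowW k w i).length = k := by
  rw [rowW, List.length_take, List.length_drop]
  rw [Nat.succ_mul] at h
  omega

/-- A row is never longer than `k`. [folklore] -/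
theorem length_rowW_le (k : ℕ) (w : List Bool) (i : ℕ) : (rowW k w i).length ≤ k := List.length_take_le _ _

/-- **The word of the matrix with row `p` moved to the top** (the other rows keep their order). [cite: AaronsonArkhipovToC2013, proof of Thm. 4.3 (p. 176: "by permuting the rows")] -/
def permW (k : ℕ) (w : List Bool) (p : ℕ) : List Bool := rowW k w p ++ (w.take (p * k) ++ w.drop ((p + 1) * k))

/-- Length of the permuted word. [folklore] -/
theorem length_permW {k : ℕ} {w : List Bool} (hw : w.length = k * k) {p : ℕ} (hp : p < k) :
    (permW k w p).length = k * k := by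
  have h1 : (p + 1) * k ≤ k * k := Nat.mul_le_mul_right k hp
  rw [permW, List.length_append, List.length_append, length_rowW (by rw [hw]; exact h1), List.length_take,
    List.length_drop, hw, min_eq_left (by nlinarith)]
  rw [Nat.succ_mul] at h1 ⊢
  omega

/-- **Bits of the permuted word**: row `0` is row `p`, rows `1 … p` are rows `0 … p-1`, rows `> p` are
unchanged. [folklore] -/
theorem getD_permW {k : ℕ} {w : List Bool} (hw : w.length = k * k) {p : ℕ} (hp : p < k) {i j : ℕ} (hi : i < k) (hj : j < k) :
    (permW k w p).getD (i * k + j) false =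
      if i = 0 then w.getD (p * k + j) false
      else if i ≤ p then w.getD ((i - 1) * k + j) false else w.getD (i * k + j) false := by
  have h1 : (p + 1) * k ≤ k * k := Nat.mul_le_mul_right k hp
  have hrow : (rowW k w p).length = k := length_rowW (by rw [hw]; exact h1)
  have htake : (w.take (p * k)).length = p * k := by
    rw [List.length_take, min_eq_left]; rw [hw]; rw [Nat.succ_mul] at h1; omega
  rw [permW]
  by_cases hi0 : i = 0
  · subst hi0
    rw [if_pos rfl, zero_mul, zero_add, List.getD_append _ _ _ _ (by rw [hrow]; exact hj), getD_rowW k w p hj]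
  · rw [if_neg hi0]
    obtain ⟨i', rfl⟩ : ∃ i', i = i' + 1 := ⟨i - 1, by omega⟩
    have hidx : (i' + 1) * k + j = (rowW k w p).length + (i' * k + j) := by rw [hrow, Nat.succ_mul]; ring
    rw [hidx, List.getD_append_right _ _ _ _ (Nat.le_add_right _ _), Nat.add_sub_cancel_left,
      show i' + 1 - 1 = i' by omega]
    by_cases hip : i' + 1 ≤ p
    · rw [if_pos hip]
      have hlt : i' * k + j < p * k := by
        have : (i' + 1) * k ≤ p * k := Nat.mul_le_mul_right k hip
        rw [Nat.succ_mul] at this; omega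
      rw [List.getD_append _ _ _ _ (by rw [htake]; exact hlt), List.getD_eq_getElem?_getD, List.getElem?_take,
        if_pos hlt, ← List.getD_eq_getElem?_getD]
    · rw [if_neg hip]
      have hge : p * k ≤ i' * k + j := by
        have : p * k ≤ i' * k := Nat.mul_le_mul_right k (by omega)
        omega
      rw [show i' * k + j = (w.take (p * k)).length + (i' * k + j - p * k) by rw [htake]; omega,
        List.getD_append_right _ _ _ _ (Nat.le_add_right _ _), Nat.add_sub_cancel_left,
        List.getD_eq_getElem?_getD, List.getElem?_drop, ← List.getD_eq_getElem?_getD]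
      congr 1
      rw [Nat.succ_mul]
      omega

/-- **The matrix of the permuted word is the permuted matrix** `X.submatrix (Fin.cons p p.succAbove) id`
(`PerSearch.perm` of `PermanentSearchReplay.lean`). [cite: AaronsonArkhipovToC2013, proof of Thm. 4.3 (p. 176)] -/
theorem wmat_permW {m : ℕ} (w : List Bool) (hw : w.length = (m + 1) * (m + 1)) (p : Fin (m + 1)) :
    wmat (m + 1) (permW (m + 1) w p) = (wmat (m + 1) w).submatrix (Fin.cons p p.succAbove) id := by
  ext i j
  rw [submatrix_apply, id]
  refine Fin.cases ?_ (fun i' => ?_) i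
  · rw [Fin.cons_zero, wmat_apply, wmat_apply, Fin.val_zero, getD_permW hw p.2 (Nat.succ_pos _) j.2, if_pos rfl]
  · rw [Fin.cons_succ, wmat_apply, wmat_apply, Fin.val_succ, getD_permW hw p.2 (by omega) j.2, if_neg (Nat.succ_ne_zero _)]
    by_cases h : i'.castSucc < p
    · have h' : (i' : ℕ) + 1 ≤ (p : ℕ) := by have := Fin.lt_def.1 h; simpa using this
      rw [Fin.succAbove_of_castSucc_lt _ _ h, if_pos h', Fin.val_castSucc, Nat.add_sub_cancel]
    · have h' : ¬ (i' : ℕ) + 1 ≤ (p : ℕ) := fun h' => h (Fin.lt_def.2 (by simpa using h'))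
      rw [Fin.succAbove_of_le_castSucc _ _ (not_lt.1 h), if_neg h', Fin.val_succ]

/-- **The word of the bottom-right minor** of a dimension-`m+1` matrix: rows `1 … m` without their
first bit, concatenated. [cite: AaronsonArkhipovToC2013, proof of Thm. 4.3 (p. 176: "the bottom-right `(n-1) × (n-1)` submatrix")] -/
def minorW (m : ℕ) (w : List Bool) : List Bool := ccat (fun i => (w.drop ((i + 1) * (m + 1) + 1)).take m) m

/-- The row pieces of the minor have length `m`. [folklore] -/
theorem length_minorPiece {m : ℕ} {w : List Bool} (hw : (m + 1) * (m + 1) ≤ w.length) {i : ℕ} (hi : i < m) :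
    ((w.drop ((i + 1) * (m + 1) + 1)).take m).length = m := by
  rw [List.length_take, List.length_drop]
  have : (i + 2) * (m + 1) ≤ (m + 1) * (m + 1) := Nat.mul_le_mul_right _ (by omega)
  refine min_eq_left ?_
  have h2 : (i + 2) * (m + 1) = (i + 1) * (m + 1) + 1 + m := by ring
  omega

/-- Length of the word of the minor. [folklore] -/
theorem length_minorW {m : ℕ} {w : List Bool} (hw : (m + 1) * (m + 1) ≤ w.length) : (minorW m w).length = m * m :=
  length_ccat_of_lt _ m fun _ hi => length_minorPiece hw hi

/-- The word of the minor is never longer than `m²`. [folklore] -/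
theorem length_minorW_le (m : ℕ) (w : List Bool) : (minorW m w).length ≤ m * m :=
  length_ccat_le _ m (fun _ => List.length_take_le _ _) m

/-- **Bits of the word of the minor.** [folklore] -/
theorem getD_minorW {m : ℕ} {w : List Bool} (hw : (m + 1) * (m + 1) ≤ w.length) {i j : ℕ} (hi : i < m) (hj : j < m) :
    (minorW m w).getD (i * m + j) false = w.getD ((i + 1) * (m + 1) + (j + 1)) false := by
  rw [minorW, getD_ccat_of_lt _ false m (fun _ hi => length_minorPiece hw hi) hi hj, List.getD_eq_getElem?_getD,
    List.getElem?_take, if_pos hj, List.getElem?_drop, ← List.getD_eq_getElem?_getD]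
  congr 1
  ring

/-- **The matrix of the word of the minor is the minor** `Y.submatrix Fin.succ Fin.succ`
(`PerSearch.minor` of `PermanentSearchReplay.lean`). [cite: AaronsonArkhipovToC2013, proof of Thm. 4.3 (p. 176)] -/
theorem wmat_minorW {m : ℕ} (w : List Bool) (hw : w.length = (m + 1) * (m + 1)) :
    wmat m (minorW m w) = (wmat (m + 1) w).submatrix Fin.succ Fin.succ := by
  ext i j
  rw [submatrix_apply, wmat_apply, wmat_apply, getD_minorW hw.ge i.2 j.2, Fin.val_succ, Fin.val_succ]

/-- The pivot-test minor `X.submatrix p.succAbove Fin.succ` is the minor of the permuted matrix. [folklore] -/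
theorem submatrix_succAbove_succ {m : ℕ} (X : Matrix (Fin (m + 1)) (Fin (m + 1)) ℤ) (p : Fin (m + 1)) :
    X.submatrix p.succAbove Fin.succ = (X.submatrix (Fin.cons p p.succAbove) id).submatrix Fin.succ Fin.succ := by
  ext i j
  simp

/-! ### The bricks -/

/-- `drop` past the end is `drop` of the capped count. [folklore] -/
theorem drop_min_length {α : Type} (n : ℕ) (l : List α) : l.drop (min n l.length) = l.drop n := by
  rcases le_total n l.length with h | h
  · rw [min_eq_left h]
  · rw [min_eq_right h, List.drop_length, List.drop_eq_nil_of_le h]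

/-- `take` past the end is `take` of the capped count. [folklore] -/
theorem take_min_length {α : Type} (n : ℕ) (l : List α) : l.take (min n l.length) = l.take n := by
  rcases le_total n l.length with h | h
  · rw [min_eq_left h]
  · rw [min_eq_right h, List.take_length, List.take_of_length_le h]

/-- On `⟨⟨w, 1ᵏ⟩, 1ⁱ⟩`: **the unary product `1^{i k}` capped at `|w|`** (binary product of the two
lengths, converted back to unary with `w` as the ruler). [folklore] -/
def mulUF : List Bool → List Bool :=
  binToUnaryFn ∘ fanoutFn (fstF ∘ fstF) (prodFn ∘ fanoutFn (lenBinF ∘ sndF) (lenBinF ∘ sndF ∘ fstF))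

/-- Value of `mulUF`. [folklore] -/
theorem mulUF_apply (w : List Bool) (k i : ℕ) :
    mulUF (boolPair (boolPair w (ones k)) (ones i)) = ones (min (i * k) w.length) := by
  simp [mulUF, ones]

/-- `mulUF ∈ FP`. [cite: AroraBarak2009, §1.3] -/
theorem mulUF_mem_FP : mulUF ∈ FP :=
  comp_mem_FP binToUnaryFn_mem_FP (fanoutFn_mem_FP (comp_mem_FP fstF_mem_FP fstF_mem_FP)
    (comp_mem_FP prodFn_mem_FP (fanoutFn_mem_FP (comp_mem_FP lenBinF_mem_FP sndF_mem_FP)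
      (comp_mem_FP lenBinF_mem_FP (comp_mem_FP sndF_mem_FP fstF_mem_FP)))))

/-- `|mulUF z| ≤ |z|` on every input (the ruler is a sub-field). [folklore] -/
theorem length_mulUF_le (z : List Bool) : (mulUF z).length ≤ z.length := by
  have h : mulUF z = binToUnaryFn (boolPair (fstF (fstF z)) (prodFn (boolPair (lenBinF (sndF z)) (lenBinF (sndF (fstF z)))))) := by
    simp [mulUF]
  rw [h]
  refine (length_binToUnaryFn_boolPair_le _ _).trans ?_
  exact (length_nthF_le 0 _).trans (length_nthF_le 0 z)

/-- On `⟨⟨w, 1ᵏ⟩, 1ⁱ⟩`: **the unary product `1^{(i+1) k}` capped at `|w|`**. [folklore] -/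
def mulSuccUF : List Bool → List Bool :=
  binToUnaryFn ∘ fanoutFn (fstF ∘ fstF)
    (prodFn ∘ fanoutFn (addFn ∘ fanoutFn (lenBinF ∘ sndF) (fun _ => [true])) (lenBinF ∘ sndF ∘ fstF))

/-- Value of `mulSuccUF`. [folklore] -/
theorem mulSuccUF_apply (w : List Bool) (k i : ℕ) :
    mulSuccUF (boolPair (boolPair w (ones k)) (ones i)) = ones (min ((i + 1) * k) w.length) := by
  simp [mulSuccUF, ones]

/-- `mulSuccUF ∈ FP`. [cite: AroraBarak2009, §1.3] -/
theorem mulSuccUF_mem_FP : mulSuccUF ∈ FP :=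
  comp_mem_FP binToUnaryFn_mem_FP (fanoutFn_mem_FP (comp_mem_FP fstF_mem_FP fstF_mem_FP)
    (comp_mem_FP prodFn_mem_FP (fanoutFn_mem_FP
      (comp_mem_FP addFn_mem_FP (fanoutFn_mem_FP (comp_mem_FP lenBinF_mem_FP sndF_mem_FP) (const_mem_FP _)))
      (comp_mem_FP lenBinF_mem_FP (comp_mem_FP sndF_mem_FP fstF_mem_FP)))))

/-- `|mulSuccUF z| ≤ |z|` on every input. [folklore] -/
theorem length_mulSuccUF_le (z : List Bool) : (mulSuccUF z).length ≤ z.length := by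
  have h : mulSuccUF z = binToUnaryFn (boolPair (fstF (fstF z))
      (prodFn (boolPair (addFn (boolPair (lenBinF (sndF z)) [true])) (lenBinF (sndF (fstF z)))))) := by
    simp [mulSuccUF]
  rw [h]
  refine (length_binToUnaryFn_boolPair_le _ _).trans ?_
  exact (length_nthF_le 0 _).trans (length_nthF_le 0 z)

/-- On `⟨⟨w, 1ᵏ⟩, 1ⁱ⟩`: **row `i`** of the word, `rowW k w i`. [folklore] -/
def rowWF : List Bool → List Bool := takeFn ∘ fanoutFn (sndF ∘ fstF) (dropFn ∘ fanoutFn mulUF (fstF ∘ fstF))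

/-- `rowWF` on every input, through its fan-outs. [folklore] -/
theorem rowWF_eq (z : List Bool) : rowWF z = ((fstF (fstF z)).drop (mulUF z).length).take (sndF (fstF z)).length := by
  simp [rowWF]

/-- Value of the row brick. [folklore] -/
theorem rowWF_apply (w : List Bool) (k i : ℕ) : rowWF (boolPair (boolPair w (ones k)) (ones i)) = rowW k w i := by
  rw [rowWF_eq, fstF_boolPair, fstF_boolPair, sndF_boolPair, mulUF_apply, rowW]
  rw [show (ones (min (i * k) w.length)).length = min (i * k) w.length by simp [ones], drop_min_length,
    show (ones k).length = k by simp [ones]]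

/-- `rowWF ∈ FP`. [cite: AroraBarak2009, §1.3] -/
theorem rowWF_mem_FP : rowWF ∈ FP :=
  comp_mem_FP takeFn_mem_FP (fanoutFn_mem_FP (comp_mem_FP sndF_mem_FP fstF_mem_FP)
    (comp_mem_FP dropFn_mem_FP (fanoutFn_mem_FP mulUF_mem_FP (comp_mem_FP fstF_mem_FP fstF_mem_FP))))

/-- `|rowWF z| ≤ |z|` on every input. [folklore] -/
theorem length_rowWF_le (z : List Bool) : (rowWF z).length ≤ z.length := by
  rw [rowWF_eq]
  refine (List.length_take_le _ _).trans ?_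
  have h1 := length_fstF_sndF_le (fstF z)
  have h2 := length_fstF_sndF_le z
  omega

/-- On `⟨⟨w, 1ᵏ⟩, 1ᵖ⟩`: the rows other than row `p`, in order (`take (p k) w ++ drop ((p+1) k) w`). [folklore] -/
def permRestF : List Bool → List Bool := fun z =>
  (takeFn ∘ fanoutFn mulUF (fstF ∘ fstF)) z ++ (dropFn ∘ fanoutFn mulSuccUF (fstF ∘ fstF)) z

/-- `permRestF` on every input, through its fan-outs. [folklore] -/
theorem permRestF_eq (z : List Bool) :
    permRestF z = (fstF (fstF z)).take (mulUF z).length ++ (fstF (fstF z)).drop (mulSuccUF z).length := by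
  simp [permRestF]

/-- `permRestF ∈ FP`. [cite: AroraBarak2009, §1.3] -/
theorem permRestF_mem_FP : permRestF ∈ FP :=
  append_mem_FP (comp_mem_FP takeFn_mem_FP (fanoutFn_mem_FP mulUF_mem_FP (comp_mem_FP fstF_mem_FP fstF_mem_FP)))
    (comp_mem_FP dropFn_mem_FP (fanoutFn_mem_FP mulSuccUF_mem_FP (comp_mem_FP fstF_mem_FP fstF_mem_FP)))

/-- On `⟨⟨w, 1ᵏ⟩, 1ᵖ⟩`: **the permuted word** `permW k w p`. [cite: AaronsonArkhipovToC2013, proof of Thm. 4.3 (p. 176)] -/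
def permWF : List Bool → List Bool := fun z => rowWF z ++ permRestF z

/-- Value of the permutation brick (`p < k`, `|w| = k²`). [folklore] -/
theorem permWF_apply (w : List Bool) {k p : ℕ} (hw : w.length = k * k) (hp : p < k) :
    permWF (boolPair (boolPair w (ones k)) (ones p)) = permW k w p := by
  have h1 : (p + 1) * k ≤ w.length := by rw [hw]; exact Nat.mul_le_mul_right k hp
  have h0 : p * k ≤ w.length := le_trans (Nat.mul_le_mul_right k (Nat.le_succ p)) h1
  rw [permWF, rowWF_apply, permRestF_eq, fstF_boolPair, fstF_boolPair, mulUF_apply, mulSuccUF_apply,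
    min_eq_left h0, min_eq_left h1, permW]
  simp [ones]

/-- `permWF ∈ FP`. [cite: AroraBarak2009, §1.3] -/
theorem permWF_mem_FP : permWF ∈ FP := append_mem_FP rowWF_mem_FP permRestF_mem_FP

/-- `|permWF z| ≤ 3 |z|` on every input. [folklore] -/
theorem length_permWF_le (z : List Bool) : (permWF z).length ≤ 3 * z.length := by
  have hw : (fstF (fstF z)).length ≤ z.length := (length_nthF_le 0 _).trans (length_nthF_le 0 z)
  have h1 := length_rowWF_le z
  have h2 : (permRestF z).length ≤ 2 * z.length := by
    rw [permRestF_eq, List.length_append, List.length_drop]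
    have hd : ((fstF (fstF z)).take (mulUF z).length).length ≤ (fstF (fstF z)).length := by
      rw [List.length_take]; exact min_le_right _ _
    omega
  rw [permWF, List.length_append]
  omega

/-- On `⟨⟨w, 1ᵐ⟩, 1ⁱ⟩`: **the row piece of the minor**, `take m (drop ((i+1)(m+1)+1) w)`. [folklore] -/
def minorPieceF : List Bool → List Bool :=
  takeFn ∘ fanoutFn (sndF ∘ fstF)
    (dropFn ∘ fanoutFn
      (binToUnaryFn ∘ fanoutFn (fstF ∘ fstF)
        (addFn ∘ fanoutFn
          (prodFn ∘ fanoutFn (addFn ∘ fanoutFn (lenBinF ∘ sndF) (fun _ => [true]))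
            (addFn ∘ fanoutFn (lenBinF ∘ sndF ∘ fstF) (fun _ => [true])))
          (fun _ => [true])))
      (fstF ∘ fstF))

/-- `minorPieceF` on every input, through its fan-outs. [folklore] -/
theorem minorPieceF_eq (z : List Bool) :
    minorPieceF z = ((fstF (fstF z)).drop (((sndF z).length + 1) * ((sndF (fstF z)).length + 1) + 1)).take
      (sndF (fstF z)).length := by
  simp [minorPieceF, ones, drop_min_length]

/-- Value of the row piece of the minor. [folklore] -/
theorem minorPieceF_apply (w : List Bool) (m i : ℕ) :
    minorPieceF (boolPair (boolPair w (ones m)) (ones i)) = (w.drop ((i + 1) * (m + 1) + 1)).take m := by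
  rw [minorPieceF_eq]
  simp [ones]

/-- `minorPieceF ∈ FP`. [cite: AroraBarak2009, §1.3] -/
theorem minorPieceF_mem_FP : minorPieceF ∈ FP :=
  comp_mem_FP takeFn_mem_FP (fanoutFn_mem_FP (comp_mem_FP sndF_mem_FP fstF_mem_FP)
    (comp_mem_FP dropFn_mem_FP (fanoutFn_mem_FP
      (comp_mem_FP binToUnaryFn_mem_FP (fanoutFn_mem_FP (comp_mem_FP fstF_mem_FP fstF_mem_FP)
        (comp_mem_FP addFn_mem_FP (fanoutFn_mem_FP
          (comp_mem_FP prodFn_mem_FP (fanoutFn_mem_FP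
            (comp_mem_FP addFn_mem_FP (fanoutFn_mem_FP (comp_mem_FP lenBinF_mem_FP sndF_mem_FP) (const_mem_FP _)))
            (comp_mem_FP addFn_mem_FP (fanoutFn_mem_FP (comp_mem_FP lenBinF_mem_FP (comp_mem_FP sndF_mem_FP fstF_mem_FP))
              (const_mem_FP _)))))
          (const_mem_FP _)))))
      (comp_mem_FP fstF_mem_FP fstF_mem_FP))))

/-- The row piece is never longer than the context: `|minorPieceF z| ≤ |fstF z|`. [folklore] -/
theorem length_minorPieceF_le (z : List Bool) : (minorPieceF z).length ≤ 1 * ((fstF z).length + 1) := by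
  rw [minorPieceF_eq]
  refine (List.length_take_le _ _).trans ?_
  have := length_fstF_sndF_le (fstF z)
  omega

/-- On `⟨w, 1ᵐ⟩`: **the word of the minor** `minorW m w`, by a concatenation fold of the `m` row
pieces (clipped at the length of the context, which they never exceed). [cite: AaronsonArkhipovToC2013, proof of Thm. 4.3 (p. 176)] -/
def minorWF : List Bool → List Bool :=
  sndPow 2 ∘ foldLoop appF (clipF 1 minorPieceF) Polynomial.X ∘ setupS sndF

/-- Value of the minor brick. [folklore] -/
theorem minorWF_apply (w : List Bool) (m : ℕ) : minorWF (boolPair w (ones m)) = minorW m w := by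
  have hk : (sndF (boolPair w (ones m))).length = m := by simp [ones]
  have hle : m ≤ (Polynomial.X : Polynomial ℕ).eval (boolPair w (ones m)).length := by
    rw [Polynomial.eval_X, length_boolPair]; simp [ones]
  simp only [minorWF, Function.comp_apply, setupS_apply]
  rw [hk, foldLoop_apply _ _ hle, sndPow_succ_boolPair, sndPow_succ_boolPair, sndPow_zero_boolPair,
    foldAcc_clipF (fun j _ _ => by simpa using length_minorPieceF_le (boolPair (boolPair w (ones m)) (ones j))),
    foldAcc_appF]
  simp only [List.nil_append, Nat.zero_add, minorPieceF_apply, minorW]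

/-- `minorWF ∈ FP`. [cite: AroraBarak2009, §1.3] -/
theorem minorWF_mem_FP : minorWF ∈ FP :=
  comp_mem_FP (sndPow_mem_FP 2) (comp_mem_FP
    (foldLoop_clipF_mem_FP 1 appF_mem_FP length_appF_le minorPieceF_mem_FP _) (setupS_mem_FP sndF_mem_FP))

/-! ### Query codes: the flat form of `encodingIntMatrix` codes -/

/-- **The `encodingIntMatrix` code of a matrix, flat**: header `bin n`, fuel `1ⁿ`, and the `ccat` of
the row codes `⟨⟨1ⁿ, ccat of entry codes⟩, ε⟩` (the general form of `encode_sq_eq`). [cite: AroraBarak2009, §0.1] -/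
theorem encode_matrix_flat (n : ℕ) (M : ℕ → ℕ → ℤ) :
    encodingIntMatrix.encode ⟨n, fun i j : Fin n => M i j⟩ =
      boolPair (encodeNat n) (boolPair (ones n)
        (ccat (fun i => boolPair (boolPair (ones n) (ccat (fun j => boolPair (encodingIntBool.encode (M i j)) []) n)) []) n)) := by
  have h1 := foldr_boolPair_comp_ofFn
    (fun a : Fin n → ℤ => boolPair (List.replicate n true)
      ((List.ofFn a).foldr (fun b acc => boolPair (encodingIntBool.encode b) acc) []))
    (fun (i : ℕ) (j : Fin n) => M i j) n
  have h2 : ∀ i : ℕ, (List.ofFn fun j : Fin n => M i j).foldr (fun b acc => boolPair (encodingIntBool.encode b) acc) [] =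
      ccat (fun j => boolPair (encodingIntBool.encode (M i j)) []) n := fun i =>
    foldr_boolPair_comp_ofFn (fun b : ℤ => encodingIntBool.encode b) (fun j : ℕ => M i j) n
  simp only [h2] at h1
  simp only [encodingIntMatrix, Encoding.sigmaBool, encodingFinVec, Encoding.listBool,
    OracleCompose.unaryEncodeNat_eq_replicate, List.length_ofFn]
  exact congrArg (boolPair (encodeNat n)) (congrArg (boolPair (List.replicate n true)) h1)

/-- The first piece of a `ccat`, split off at the front. (Twin of
`Literature.Barriers.CriticalPhenomena.GridSAW.ccat_succ_left` of `GridSAWTowersEnumeration.lean`, a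
barrier file that cannot be imported into this toolkit layer; librarian: hoist both next to `ccat_succ`
in `Complexity/EncodingFrames.lean`.) [folklore] -/
theorem ccat_succ_left (g : ℕ → List Bool) : ∀ n : ℕ, ccat g (n + 1) = g 0 ++ ccat (fun i => g (i + 1)) n
  | 0 => by simp [ccat_succ]
  | n + 1 => by rw [ccat_succ, ccat_succ_left g n, List.append_assoc, ← ccat_succ]

/-- **The transcoder's `matC` codes the matrix of a word of square length**:
`matC w = ⟨k, wmat k w⟩` for `|w| = k²`. [folklore] -/
theorem matC_wmat {k : ℕ} (w : List Bool) (hw : w.length = k * k) :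
    matC w = encodingIntMatrix.encode ⟨k, fun a b => wmat k w a b⟩ := by
  rw [matC_apply, hw, Nat.sqrt_eq]
  rfl

/-! ### The code of the scaled matrix `X^{[r]}` -/

/-- Entry `(i, j)` of the scaled matrix of a word: row `0` is `D x₀ⱼ − [j = 0] a`, the other rows are
those of the word. [cite: AaronsonArkhipovToC2013, proof of Thm. 4.3, eq. (4.3) (p. 176)] -/
def scaleEnt (k : ℕ) (w : List Bool) (a : ℤ) (D : ℕ) (i j : ℕ) : ℤ :=
  if i = 0 then (D : ℤ) * (if w.getD j false then 1 else 0) - (if j = 0 then a else 0)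
  else if w.getD (i * k + j) false then 1 else 0

/-- **The scaled matrix of a word.** [cite: AaronsonArkhipovToC2013, proof of Thm. 4.3, eq. (4.3) (p. 176)] -/
def scaleW (k : ℕ) (w : List Bool) (a : ℤ) (D : ℕ) : Matrix (Fin k) (Fin k) ℤ :=
  Matrix.of fun i j => scaleEnt k w a D i j

/-- **`scaledMatrix` of the matrix of a word is the scaled matrix of the word** (numerator and
denominator of the point). [cite: AaronsonArkhipovToC2013, proof of Thm. 4.3, eq. (4.3) (p. 176)] -/
theorem scaledMatrix_wmat {m : ℕ} (w : List Bool) (r : ℚ) :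
    scaledMatrix (wmat (m + 1) w) r = scaleW (m + 1) w r.num r.den := by
  ext i j
  simp only [scaledMatrix, scaleW, scaleEnt, Matrix.of_apply, updateRow_apply, wmat_apply, Fin.ext_iff, Fin.val_zero,
    zero_mul, zero_add]

/-- `(w.drop j).take 1 = [1]` iff bit `j` of `w` is set. (Twin of
`Literature.Computability.Cryptography.ZhandrySim.take_one_drop_eq_iff` of
`Cryptography/ZhandryOracleSimulator.lean`, whose import closure (the quantum random-oracle
development) is not wanted here; librarian: hoist both next to `take_one_drop_min_eq_iff` in
`FPStringBricks.lean`.) [folklore] -/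
theorem take_one_drop_eq_iff (w : List Bool) (j : ℕ) : (w.drop j).take 1 = [true] ↔ w.getD j false = true := by
  have := take_one_drop_min_eq_iff w j
  rwa [drop_min_length] at this

/-- On `⟨x, 1ʲ⟩` with the context `x = ⟨⟨w, 1ᵏ⟩, ⟨A, D⟩⟩`: the bit test `[x₀ⱼ = 1]`. [folklore] -/
def bit0T : List Bool → List Bool :=
  eqPairFn ∘ fanoutFn (bitAtFn ∘ fanoutFn sndF (fstF ∘ fstF ∘ fstF)) (fun _ => [true])

/-- Value of the bit test. [folklore] -/
theorem bit0T_apply (w u A D : List Bool) (j : ℕ) :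
    bit0T (boolPair (boolPair (boolPair w u) (boolPair A D)) (ones j)) = [w.getD j false] := by
  simp only [bit0T, Function.comp_apply, fanoutFn_apply, sndF_boolPair, fstF_boolPair, bitAtFn_boolPair, eqPairFn_boolPair]
  rw [show (ones j).length = j by simp [ones]]
  congr 1
  rw [← Bool.decide_eq_true (b := w.getD j false)]
  exact Bool.decide_congr (take_one_drop_eq_iff w j)

/-- `bit0T ∈ FP`. [cite: AroraBarak2009, §1.3] -/
theorem bit0T_mem_FP : bit0T ∈ FP :=
  comp_mem_FP eqPairFn_mem_FP (fanoutFn_mem_FP (comp_mem_FP bitAtFn_mem_FP (fanoutFn_mem_FP sndF_mem_FP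
    (comp_mem_FP fstF_mem_FP (comp_mem_FP fstF_mem_FP fstF_mem_FP)))) (const_mem_FP _))

/-- `bit0T` is one-bit. [folklore] -/
theorem oneBit_bit0T : OneBit bit0T := fun z => ⟨_, by rw [bit0T, Function.comp_apply, fanoutFn_apply, eqPairFn_boolPair]⟩

/-- On `⟨x, 1ʲ⟩`: **the value of entry `(0, j)` of the scaled matrix** as a canonical difference pair,
`dpEnc (D x₀ⱼ − [j = 0] a)` — the difference of `⟨D or ε, ε⟩` and `A` or `⟨ε, ε⟩`. [cite: AaronsonArkhipovToC2013, proof of Thm. 4.3, eq. (4.3) (p. 176)] -/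
def ent0V : List Bool → List Bool :=
  zsubF ∘ fanoutFn
    (fanoutFn (iteFn bit0T (sndF ∘ sndF ∘ fstF) (fun _ => [])) (fun _ => []))
    (iteFn (isNilFn ∘ sndF) (fstF ∘ sndF ∘ fstF) (fun _ => boolPair [] []))

/-- Value of the entry brick. [folklore] -/
theorem ent0V_apply (w u A D : List Bool) (j : ℕ) :
    ent0V (boolPair (boolPair (boolPair w u) (boolPair A D)) (ones j)) =
      dpEnc ((bitsToNat D : ℤ) * (if w.getD j false then 1 else 0) - (if j = 0 then ival A else 0)) := by
  have hb := bit0T_apply w u A D j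
  rw [ent0V, Function.comp_apply, fanoutFn_apply, fanoutFn_apply, iteFn_apply hb, zsubF_boolPair, ival_boolPair]
  have h2 : (isNilFn ∘ sndF) (boolPair (boolPair (boolPair w u) (boolPair A D)) (ones j)) = [decide (j = 0)] := by
    cases j <;> simp [isNilFn, ones]
  rw [iteFn_apply h2]
  congr 1
  cases hbit : w.getD j false <;> by_cases hj : j = 0 <;> simp [hj, ival_boolPair]

/-- `ent0V ∈ FP`. [cite: AroraBarak2009, §1.3] -/
theorem ent0V_mem_FP : ent0V ∈ FP :=
  comp_mem_FP zsubF_mem_FP (fanoutFn_mem_FP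
    (fanoutFn_mem_FP (iteFn_mem_FP bit0T_mem_FP (comp_mem_FP sndF_mem_FP (comp_mem_FP sndF_mem_FP fstF_mem_FP)) (const_mem_FP _))
      (const_mem_FP _))
    (iteFn_mem_FP (comp_mem_FP isNilFn_mem_FP sndF_mem_FP) (comp_mem_FP fstF_mem_FP (comp_mem_FP sndF_mem_FP fstF_mem_FP))
      (const_mem_FP _)))

/-- The entry value is short: `|ent0V z| ≤ 2 |fstF z| + 4` on every input. [folklore] -/
theorem length_ent0V_le (z : List Bool) : (ent0V z).length ≤ 2 * (fstF z).length + 4 := by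
  have hx := length_fstF_sndF_le (fstF z)
  have hAD := length_fstF_sndF_le (sndF (fstF z))
  rw [ent0V, Function.comp_apply, fanoutFn_apply]
  refine (length_zsubF_le _ _).trans ?_
  have h1 : zlen (fanoutFn (iteFn bit0T (sndF ∘ sndF ∘ fstF) fun _ => []) (fun _ => []) z) ≤ (sndF (sndF (fstF z))).length := by
    rw [fanoutFn_apply, zlen_boolPair, List.length_nil, add_zero, iteFn_of_oneBit oneBit_bit0T]
    split_ifs <;> simp
  have h2 : zlen (iteFn (isNilFn ∘ sndF) (fstF ∘ sndF ∘ fstF) (fun _ => boolPair [] []) z) ≤ (fstF (sndF (fstF z))).length := by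
    rw [iteFn_of_oneBit (oneBit_isNilFn.comp _)]
    split_ifs
    · exact zlen_le_length _
    · simp [zlen_boolPair]
  have := max_le_max h1 h2
  have hm : max (sndF (sndF (fstF z))).length (fstF (sndF (fstF z))).length ≤ (fstF z).length := by
    refine max_le ?_ ?_ <;> omega
  omega

/-- On `⟨x, 1ʲ⟩`: **the code of entry `(0, j)`** (sign–magnitude, `encodingIntBool`). [folklore] -/
def ent0C : List Bool → List Bool := signMagOfZF ∘ ent0V

/-- Value of the entry code brick. [folklore] -/
theorem ent0C_apply (w : List Bool) (k : ℕ) (A D : List Bool) (j : ℕ) :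
    ent0C (boolPair (boolPair (boolPair w (ones k)) (boolPair A D)) (ones j)) =
      encodingIntBool.encode (scaleEnt k w (ival A) (bitsToNat D) 0 j) := by
  rw [ent0C, Function.comp_apply, ent0V_apply, signMagOfZF_dpEnc, scaleEnt, if_pos rfl]
  rfl

/-- `ent0C ∈ FP`. [cite: AroraBarak2009, §1.3] -/
theorem ent0C_mem_FP : ent0C ∈ FP := comp_mem_FP signMagOfZF_mem_FP ent0V_mem_FP

/-- The entry code is short: `|ent0C z| ≤ 2 |fstF z| + 9`. [folklore] -/
theorem length_ent0C_le (z : List Bool) : (ent0C z).length ≤ 2 * (fstF z).length + 9 := by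
  rw [ent0C, Function.comp_apply]
  refine (length_signMagOfZF_le _).trans ?_
  have := (zlen_le_length (ent0V z)).trans (length_ent0V_le z)
  omega

/-- On the context `x = ⟨⟨w, 1ᵏ⟩, ⟨A, D⟩⟩`: **the code of row `0`** of the scaled matrix (fuel and
the fold of the entry codes). [folklore] -/
def row0C : List Bool → List Bool :=
  fanoutFn (sndF ∘ fstF) (sndPow 2 ∘ foldLoop appF (clipF 20 (fanoutFn ent0C fun _ => [])) Polynomial.X ∘ setupS (sndF ∘ fstF))

/-- Value of the row-`0` code. [folklore] -/
theorem row0C_apply (w : List Bool) (k : ℕ) (A D : List Bool) :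
    row0C (boolPair (boolPair w (ones k)) (boolPair A D)) =
      boolPair (ones k) (ccat (fun j => boolPair (encodingIntBool.encode (scaleEnt k w (ival A) (bitsToNat D) 0 j)) []) k) := by
  set x := boolPair (boolPair w (ones k)) (boolPair A D) with hx
  have hk : (sndF (fstF x)).length = k := by simp [hx, ones]
  have hle : k ≤ (Polynomial.X : Polynomial ℕ).eval x.length := by
    rw [Polynomial.eval_X, hx, length_boolPair, length_boolPair]; simp [ones]; omega
  simp only [row0C, Function.comp_apply, fanoutFn_apply, setupS_apply]
  rw [hk, foldLoop_apply _ _ hle, sndPow_succ_boolPair, sndPow_succ_boolPair, sndPow_zero_boolPair,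
    foldAcc_clipF (fun j _ _ => by
      rw [fanoutFn_apply, length_boolPair, List.length_nil]
      have := length_ent0C_le (boolPair x (ones j))
      rw [fstF_boolPair] at this
      omega), foldAcc_appF]
  simp only [List.nil_append, Nat.zero_add, fanoutFn_apply, hx, ent0C_apply, sndF_boolPair, fstF_boolPair]

/-- `row0C ∈ FP`. [cite: AroraBarak2009, §1.3] -/
theorem row0C_mem_FP : row0C ∈ FP :=
  fanoutFn_mem_FP (comp_mem_FP sndF_mem_FP fstF_mem_FP) (comp_mem_FP (sndPow_mem_FP 2) (comp_mem_FP
    (foldLoop_clipF_mem_FP 20 appF_mem_FP length_appF_le (fanoutFn_mem_FP ent0C_mem_FP (const_mem_FP _)) _)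
    (setupS_mem_FP (comp_mem_FP sndF_mem_FP fstF_mem_FP))))

/-- On `⟨x, 1ⁱ⟩`: the framed code of row `i + 1` (a `0/1` row: the transcoder's `rowC`). [folklore] -/
def rowPieceC : List Bool → List Bool :=
  fanoutFn (rowC ∘ fanoutFn (fstF ∘ fstF ∘ fstF) (List.cons true ∘ sndF)) fun _ => []

/-- Value of the row piece. [folklore] -/
theorem rowPieceC_apply (w u q : List Bool) (i : ℕ) :
    rowPieceC (boolPair (boolPair (boolPair w u) q) (ones i)) = boolPair (rowCode w (Nat.sqrt w.length) (i + 1)) [] := by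
  rw [rowPieceC, fanoutFn_apply, Function.comp_apply, fanoutFn_apply, Function.comp_apply, Function.comp_apply,
    Function.comp_apply, fstF_boolPair, fstF_boolPair, fstF_boolPair, sndF_boolPair, ← Com.ones_succ, rowC_apply]

/-- `rowPieceC ∈ FP`. [cite: AroraBarak2009, §1.3] -/
theorem rowPieceC_mem_FP : rowPieceC ∈ FP :=
  fanoutFn_mem_FP (comp_mem_FP rowC_mem_FP (fanoutFn_mem_FP (comp_mem_FP fstF_mem_FP (comp_mem_FP fstF_mem_FP fstF_mem_FP))
    (comp_mem_FP (cons_mem_FP true) sndF_mem_FP))) (const_mem_FP _)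

/-- On the context `x`: **the framed codes of rows `1 … k-1`**, by a fold of `k - 1` row pieces. [folklore] -/
def rowsC : List Bool → List Bool :=
  sndPow 2 ∘ foldLoop appF (clipF 34 rowPieceC) Polynomial.X ∘ setupS (dropFn ∘ fanoutFn (fun _ => [true]) (sndF ∘ fstF))

/-- Value of the rows code (`|w| = k²`). [folklore] -/
theorem rowsC_apply (w : List Bool) {k : ℕ} (hw : w.length = k * k) (q : List Bool) :
    rowsC (boolPair (boolPair w (ones k)) q) = ccat (fun i => boolPair (rowCode w k (i + 1)) []) (k - 1) := by
  set x := boolPair (boolPair w (ones k)) q with hx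
  have hk : (dropFn (fanoutFn (fun _ => [true]) (sndF ∘ fstF) x)).length = k - 1 := by
    simp [hx, ones]
  have hle : k - 1 ≤ (Polynomial.X : Polynomial ℕ).eval x.length := by
    rw [Polynomial.eval_X, hx, length_boolPair, length_boolPair]; simp [ones]; omega
  simp only [rowsC, Function.comp_apply, setupS_apply]
  rw [hk, foldLoop_apply _ _ hle, sndPow_succ_boolPair, sndPow_succ_boolPair, sndPow_zero_boolPair,
    foldAcc_clipF (fun j _ _ => by
      rw [hx, rowPieceC_apply, length_boolPair, List.length_nil, length_boolPair, length_boolPair]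
      have := length_rowCode_le w (j + 1)
      omega), foldAcc_appF]
  simp only [List.nil_append, Nat.zero_add, hx, rowPieceC_apply, hw, Nat.sqrt_eq]

/-- `rowsC ∈ FP`. [cite: AroraBarak2009, §1.3] -/
theorem rowsC_mem_FP : rowsC ∈ FP :=
  comp_mem_FP (sndPow_mem_FP 2) (comp_mem_FP (foldLoop_clipF_mem_FP 34 appF_mem_FP length_appF_le rowPieceC_mem_FP _)
    (setupS_mem_FP (comp_mem_FP dropFn_mem_FP (fanoutFn_mem_FP (const_mem_FP _) (comp_mem_FP sndF_mem_FP fstF_mem_FP)))))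

/-- The body of the matrix code: the framed row-`0` code followed by the other framed rows. [folklore] -/
def smatBodyC : List Bool → List Bool := fun x => (fanoutFn row0C fun _ => []) x ++ rowsC x

/-- `smatBodyC ∈ FP`. [cite: AroraBarak2009, §1.3] -/
theorem smatBodyC_mem_FP : smatBodyC ∈ FP := append_mem_FP (fanoutFn_mem_FP row0C_mem_FP (const_mem_FP _)) rowsC_mem_FP

/-- On `⟨⟨w, 1ᵏ⟩, ⟨A, D⟩⟩`: **the code of the scaled matrix** (header `bin k`, fuel `1ᵏ`, rows). [cite: AaronsonArkhipovToC2013, proof of Thm. 4.3, eq. (4.3) (p. 176)] -/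
def smatC : List Bool → List Bool := fanoutFn (lenBinF ∘ sndF ∘ fstF) (fanoutFn (sndF ∘ fstF) smatBodyC)

/-- `smatC ∈ FP`. [cite: AroraBarak2009, §1.3] -/
theorem smatC_mem_FP : smatC ∈ FP :=
  fanoutFn_mem_FP (comp_mem_FP lenBinF_mem_FP (comp_mem_FP sndF_mem_FP fstF_mem_FP))
    (fanoutFn_mem_FP (comp_mem_FP sndF_mem_FP fstF_mem_FP) smatBodyC_mem_FP)

/-- The rows `≥ 1` of the scaled matrix code as the transcoder writes them. [folklore] -/
theorem rowCode_eq_scaleEnt (w : List Bool) (k : ℕ) (a : ℤ) (D : ℕ) (i : ℕ) :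
    rowCode w k (i + 1) = boolPair (ones k) (ccat (fun j => boolPair (encodingIntBool.encode (scaleEnt k w a D (i + 1) j)) []) k) := by
  rw [rowCode]
  congr 1
  refine ccat_congr fun j _ => ?_
  rw [scaleEnt, if_neg (Nat.succ_ne_zero i), encodingIntBool_encode_bit]

/-- **`smatC` meets its specification**: the `encodingIntMatrix` code of the scaled matrix
(`|w| = k²`, `k ≥ 1`). [cite: AaronsonArkhipovToC2013, proof of Thm. 4.3, eq. (4.3) (p. 176)] -/
theorem smatC_apply (w : List Bool) {k : ℕ} (hw : w.length = k * k) (hk : 1 ≤ k) (A D : List Bool) :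
    smatC (boolPair (boolPair w (ones k)) (boolPair A D)) =
      encodingIntMatrix.encode ⟨k, fun i j => scaleW k w (ival A) (bitsToNat D) i j⟩ := by
  have hflat := encode_matrix_flat k (scaleEnt k w (ival A) (bitsToNat D))
  rw [show (fun i j : Fin k => scaleEnt k w (ival A) (bitsToNat D) i j) = fun i j => scaleW k w (ival A) (bitsToNat D) i j
    from rfl] at hflat
  rw [hflat]
  obtain ⟨k', rfl⟩ : ∃ k', k = k' + 1 := ⟨k - 1, by omega⟩
  rw [ccat_succ_left]
  simp only [smatC, smatBodyC, fanoutFn_apply, Function.comp_apply, sndF_boolPair, fstF_boolPair, lenBinF_apply,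
    row0C_apply, rowsC_apply w hw, Nat.add_sub_cancel]
  rw [show (ones (k' + 1)).length = k' + 1 by simp [ones]]
  congr 3
  refine ccat_congr fun i _ => ?_
  rw [rowCode_eq_scaleEnt]

end PerSearch

end Literature.Computability.QuantumComplexity

end
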